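/-
Copyright (c) 2026 the pub-hodgecm-mathlib formalisation cell (harness21).  Prover seat hodgecm-mathlib-F0P3-p01 (g33), Track A «(D-RAM) FOUR-FRAME», unit U2H, census leaf
(ρ2b′-X) — T5b «TORIC LEVEL CENSUS, type RamK»: (D3-LAW) prerequisites — the top depth SUPPLIER-FREE, and the two line models reduced to ONE unit.  2026-09-04.
-/
import Summits.HodgeConjecture.HodgeConjecture.Theorems.F0P3cDyRamTopSideRamK                 -- ★ p857901 (LH4-p13 (g6)); brings ★ p857887 `add_le_of_thetaFixed_normOne_near`, ★ (M-RK1) `exists_fixed_mul_near_one_iff_mem_order`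
import Summits.HodgeConjecture.HodgeConjecture.Theorems.F0P3cDyRamTopBitNormBridge            -- ★ p857848 (LH4-p13 (g6)): `topBit_iff_exists_norm_decomp`; brings ★ `exists_fixed_coords_of_map_ne`, ★ `exists_eq_varpi_zpow_mul_unit`
import Literature.NumberTheory.LocalFields.QuadraticOrderNormTwistClasses                      -- ★ `exists_unit_twist_eq_of_isotropic` (the hyperbolic translator)
import Literature.NumberTheory.LocalFields.QuadraticDatumAntiFixedUnitSplitting                -- ★ p857774 (g32, B5): `isotropic_of_mul_map_eq`
import HarnessLib

/-!
# (ρ2b′-X) T5b — (D3-LAW) type RamK, part 1: the top depth SUPPLIER-FREE, and the two line models in one unit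

`Summits/HodgeConjecture/HodgeConjecture/Theorems/F0P3cDyRamToricLevelCensusRamKTopLaw.lean`, namespace
`Summit.HodgeConjecture.HodgeConjecture.Cruxes.H413.F0P3cDyRamToricLevelCensusRamK` (fifth file of the T5b HEAD namespace).  PROOF FILE of a SUPPORT organ
(`--supports stmt-HodgeConjecture-24833 --as helper`; no stub credit claimed; hodgecm-mathlib-F0P3-p01 (g33) for the (ρ2b′-X) payer LH4-p14's lineage, dealer LH4-plan (g12)).
THEOREMS ONLY (no `def`, no instance, no notation, no sorry).

WHAT.  ★ g32 `ncard_levelSetDep_top_mul_eq_of_ramK` prints the (D3) top cell as `#levelSetDep(j,a;μ)·idxRK(q,d,s₀) = |G_j|·BIT(h,μ,s₀)` with the HONEST token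
`BIT(h,μ,c) := ∃ ω₁ ∈ 𝒪_Mˣ, |1 + (ρh∕h)∕(ρμ∕μ)·ρ(ω₁Θω₁)∕(ω₁Θω₁)| ≤ exp(−c)`; LH4-p13 (g6) evaluated it in the norm-decomposition letters `z = k·e·w` (★ p857848 bridge,
★ p857887 top depth — modulo the `K♮`-side suppliers `hsurjD`, `hH90` —, ★ p857901 sides — modulo `hdich`, `n₀`, `hNF`, `hNd`).  THIS FILE:
* §1 **`exists_thetaFixed_unit_near_top`** — a SUPPLIER-FREE `Θ`-fixed unit witness AT THE TOP DEPTH `D = jλ − d + 1`: for `κρκ = 1` with `|κ − Θκ| = exp(−jλ)`, `d ≤ jλ`,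
  there is a `Θ`-fixed unit `N` with `|κN − ρN| ≤ exp(−D)`.  Mechanism (no Hensel, no norm equation): `K♮`-coordinates `κ = g₀ + g₁ϖE` (`Θg_i = g_i`), `κ − Θκ = g₁(ϖE − ΘϖE)` so
  `|g₁ϖE| = exp(−D)`, `|g₀ρg₀ − 1| ≤ exp(−D)`; then `N := x + g₀⁻¹ρx` for `x ∈ {1, αK}` (`αK` the `Θ`-fixed unramified generator) is `Θ`-fixed with `ρN − g₀N = −xη∕ρg₀`, and one of
  the two choices is a unit because `|αK − ραK| = 1`.
* §2 **`exists_topDecomp_iff_le`** — the TOP-DEPTH LAW of ★ p857887 WITHOUT `hsurjD`∕`hH90`: for a unit `z` with `ρz = κz`, `1 ≤ c`: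
  `(∃ k e w, Θk = k ∧ |k| = 1 ∧ ρe = e ∧ |e| = 1 ∧ |w − 1| ≤ exp(−c) ∧ z = k·e·w) ⟺ c + d ≤ jλ + 1` (⟹ ★ `add_le_of_thetaFixed_normOne_near`; ⟸ §1 + ★ (M-RK1) `𝒪_cˣ = 𝒪_Eˣ·U^{(c)}`).
* §3 THE TWO LINE MODELS IN ONE UNIT: from `hhyper` (★ translator `η·t(ω₀) = −1`) the unit `z := (unit part of μ·h·N(ω₀)·(αK − ραK))` has `ρz = κz` and `BIT(h,μ,c) ⟺ ALIVE(z,c)`;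
  from `haniso` the other scalar is `h′ = h·N(ω₀)·n₀·π₂^{-n}` with `n₀` a `Θ`-fixed unit NON-norm and `BIT(h′,μ,c) ⟺ ALIVE(z·n₀,c)` (★ bridge twice; ★ B5 `isotropic_of_mul_map_eq`).
SEQUEL (`…ToricLevelCensusRamKTopValue`): the law in BIT letters with the side suppliers DISCHARGED from the two-field RamK frame (near cells both sides, far cells exactly
one side, constancy) and THE (D3) ROW IN `hvTop` VALUE FORM (★ p857635 `toricCensusSum_ramK`'s letters), then the T5b × T5s WELD.
HONEST LABEL: HC_CM is proved only modulo the 7 printed citations (2 remaining named inputs: hLiu418 = stmt-HodgeConjecture-24832, h413 = stmt-HodgeConjecture-24833) until rung 0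
closes; (ρ2b′-X) is OPEN; this leaf is unconditional local algebra and count-neutral.

## References
* [Serre1979] J.-P. Serre, *Local Fields*, GTM 67 (1979): Ch. III §6 Prop. 12 (orders), Ch. V §2 Prop. 3, §3 Prop. 5 and Cor. 3 (norm groups), Ch. X §1 (Hilbert 90).
* [Jacobowitz1962] R. Jacobowitz, *Hermitian forms over local fields*, Amer. J. Math. 84 (1962): §4 (duals, modular lattices).
* [Flicker1998UnitaryFL] Y. Z. Flicker, *Elementary proof of the fundamental lemma for a unitary group*, Canad. J. Math. 50 (1998): Prop. 7 p. 84 (level tables).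
* [Kottwitz1986BaseChangeUnits] R. E. Kottwitz, *Base change for unit elements of Hecke algebras*, Compositio Math. 60 (1986): §1 pp. 240–241 (the depth ∕ tube condition).
-/

set_option autoImplicit false

namespace Summit.HodgeConjecture.HodgeConjecture.Cruxes.H413.F0P3cDyRamToricLevelCensusRamK

open WithZero
open scoped Valued
open Literature.NumberTheory.LocalFields (exists_fixed_coords_of_map_ne)
open Literature.NumberTheory.LocalFields.QuadraticOrder
open Literature.NumberTheory.LocalFields.WildQuadraticDatum (v_varpi_pow)
open Summit.HodgeConjecture.HodgeConjecture.Cruxes.H413.F0P3cDyRamTopDepthRamK (v_eq_one_of_mul_map_eq_one v_eq_one_of_v_sub_one_le add_le_of_thetaFixed_normOne_near)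

variable {K : Type} [Field K] [Valued K ℤᵐ⁰] {ρ Θ : K →+* K} {ϖE : K}

/-! ## §1 A supplier-free `Θ`-fixed unit witness at the top depth `D = jλ − d + 1` -/

/-- **TOP WITNESS, SUPPLIER-FREE.**  Frame: `ρ, Θ` commuting involutions, isometric; `ϖE` a `ρ`-fixed uniformiser with `|ϖE − ΘϖE| = |ϖE|^d` (the RamK datum clause);
`αK` integral, `Θ`-FIXED, `|αK − ραK| = 1` (the unramified generator of the third field; NO parity clause is needed).  For `κ` with `κρκ = 1`,
`|κ − Θκ| = exp(−jλ)` and `d ≤ jλ` there is a `Θ`-fixed UNIT `N` with `|κ·N − ρN| ≤ exp(−(jλ − d + 1))` — `κ` is within `exp(−D)` of the torus `T♮ = {ρN∕N}`.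
Mechanism: `κ = g₀ + g₁ϖE` with `Θg_i = g_i`, `|g₁ϖE| = exp(−D)`, `|g₀ρg₀ − 1| ≤ exp(−D)`; `N := x + g₀⁻¹ρx`, `x ∈ {1, αK}`. [cite: Serre1979, Ch. X §1; Ch. III §6 Prop. 12] -/
theorem exists_thetaFixed_unit_near_top (hρρ : ∀ x, ρ (ρ x) = x) (hΘΘ : ∀ x, Θ (Θ x) = x) (hΘρ : ∀ x, Θ (ρ x) = ρ (Θ x))
    (hvρ : ∀ x, Valued.v (ρ x) = Valued.v x)
    (hϖE : Valued.v ϖE = exp (-1 : ℤ)) (hρϖ : ρ ϖE = ϖE) {d : ℕ} (hdatum : Valued.v (ϖE - Θ ϖE) = Valued.v ϖE ^ d)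
    {αK : K} (hΘαK : Θ αK = αK) (hαK1 : Valued.v αK ≤ 1) (hαKρ : Valued.v (αK - ρ αK) = 1)
    {κ : K} (hκ : κ * ρ κ = 1) {jl : ℕ} (hκΘ : Valued.v (κ - Θ κ) = exp (-(jl : ℤ))) (hjl : d ≤ jl) :
    ∃ N : K, Θ N = N ∧ Valued.v N = 1 ∧ Valued.v (κ * N - ρ N) ≤ exp (-((jl : ℤ) - d + 1)) := by
  have hκ1 : Valued.v κ = 1 := v_eq_one_of_mul_map_eq_one hvρ hκ
  have hκ0 : κ ≠ 0 := fun h0 => by rw [h0, map_zero] at hκ1; exact zero_ne_one hκ1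
  have hρκ : ρ κ = κ⁻¹ := eq_inv_of_mul_eq_one_right hκ
  have hΘϖ : Θ ϖE ≠ ϖE := fun h0 => by
    rw [h0, sub_self, map_zero, v_varpi_pow hϖE] at hdatum
    exact exp_ne_zero hdatum.symm
  -- ## `K♮`-coordinates of `κ` with respect to `ϖE`
  obtain ⟨g₀, g₁, hg₀, hg₁, hκeq⟩ := exists_fixed_coords_of_map_ne hΘΘ hΘϖ κ
  have hdiff : κ - Θ κ = g₁ * (ϖE - Θ ϖE) := by rw [hκeq, map_add, map_mul, hg₀, hg₁]; ring
  have hD : Valued.v (g₁ * ϖE) = exp (-((jl : ℤ) - d + 1)) := by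
    have h1 : Valued.v g₁ * exp (-(d : ℤ)) = exp (-(jl : ℤ)) := by rw [← v_varpi_pow hϖE, ← hdatum, ← Valuation.map_mul, ← hdiff, hκΘ]
    have h2 : Valued.v g₁ = exp (-(jl : ℤ) + d) :=
      calc Valued.v g₁ = Valued.v g₁ * exp (-(d : ℤ)) * exp (d : ℤ) := by rw [mul_assoc, ← exp_add, neg_add_cancel, exp_zero, mul_one]
        _ = exp (-(jl : ℤ) + d) := by rw [h1, ← exp_add]
    rw [Valuation.map_mul, h2, hϖE, ← exp_add]; congr 1; ring
  have hDlt : exp (-((jl : ℤ) - d + 1)) < 1 := by rw [← exp_zero, exp_lt_exp]; omega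
  have hg₀eq : g₀ = κ + -(g₁ * ϖE) := by rw [hκeq]; ring
  have hvg₀ : Valued.v g₀ = 1 := by
    rw [hg₀eq, Valuation.map_add_eq_of_lt_left _ (by rw [Valuation.map_neg, hD, hκ1]; exact hDlt), hκ1]
  have hg₀0 : g₀ ≠ 0 := fun h0 => by rw [h0, map_zero] at hvg₀; exact zero_ne_one hvg₀
  have hρg₀0 : ρ g₀ ≠ 0 := (map_ne_zero ρ).2 hg₀0
  have hvρg₀ : Valued.v (ρ g₀) = 1 := by rw [hvρ, hvg₀]
  -- ## `η := g₀ρg₀ − 1` is `exp(−D)`-small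
  have hρP : ρ (g₁ * ϖE) = ρ g₁ * ϖE := by rw [map_mul, hρϖ]
  have hηeq : g₀ * ρ g₀ - 1 = -((g₁ * ϖE) * ρ κ + κ * ρ (g₁ * ϖE)) + (g₁ * ϖE) * ρ (g₁ * ϖE) := by
    have hρg₀ : ρ g₀ = ρ κ - ρ (g₁ * ϖE) := by rw [hg₀eq, map_add, map_neg]; ring
    rw [hρg₀, hg₀eq]; linear_combination hκ
  have hvρP : Valued.v (ρ (g₁ * ϖE)) = exp (-((jl : ℤ) - d + 1)) := by rw [hvρ, hD]
  have hη : Valued.v (g₀ * ρ g₀ - 1) ≤ exp (-((jl : ℤ) - d + 1)) := by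
    rw [hηeq]
    refine (Valuation.map_add _ _ _).trans (max_le ?_ ?_)
    · rw [Valuation.map_neg]
      refine (Valuation.map_add _ _ _).trans (max_le ?_ ?_)
      · rw [Valuation.map_mul, hD, hvρ, hκ1, mul_one]
      · rw [Valuation.map_mul, hκ1, hvρP, one_mul]
    · rw [Valuation.map_mul, hD, hvρP]
      calc exp (-((jl : ℤ) - d + 1)) * exp (-((jl : ℤ) - d + 1)) ≤ exp (-((jl : ℤ) - d + 1)) * 1 := by gcongr
        _ = exp (-((jl : ℤ) - d + 1)) := mul_one _
  -- ## the candidate witnesses `N_x := x + g₀⁻¹·ρx`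
  have hwit : ∀ x : K, Θ x = x → Valued.v x ≤ 1 →
      Θ (x + g₀⁻¹ * ρ x) = x + g₀⁻¹ * ρ x ∧ Valued.v (κ * (x + g₀⁻¹ * ρ x) - ρ (x + g₀⁻¹ * ρ x)) ≤ exp (-((jl : ℤ) - d + 1)) := by
    intro x hΘx hx1
    refine ⟨by rw [map_add, map_mul, map_inv₀, hg₀, hΘρ, hΘx], ?_⟩
    have hρN : ρ (x + g₀⁻¹ * ρ x) - g₀ * (x + g₀⁻¹ * ρ x) = -(x * (g₀ * ρ g₀ - 1) / ρ g₀) := by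
      rw [map_add, map_mul, map_inv₀, hρρ]; field_simp; ring
    have h1 : κ * (x + g₀⁻¹ * ρ x) - ρ (x + g₀⁻¹ * ρ x) =
        (κ - g₀) * (x + g₀⁻¹ * ρ x) - (ρ (x + g₀⁻¹ * ρ x) - g₀ * (x + g₀⁻¹ * ρ x)) := by ring
    have hN1 : Valued.v (x + g₀⁻¹ * ρ x) ≤ 1 :=
      (Valuation.map_add _ _ _).trans (max_le hx1 (by rw [Valuation.map_mul, map_inv₀, hvg₀, inv_one, one_mul, hvρ]; exact hx1))
    rw [h1]
    refine (Valuation.map_sub _ _ _).trans (max_le ?_ ?_)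
    · rw [Valuation.map_mul, show κ - g₀ = g₁ * ϖE by rw [hg₀eq]; ring, hD]
      exact mul_le_of_le_one_right' hN1
    · rw [hρN, Valuation.map_neg, map_div₀, hvρg₀, div_one, Valuation.map_mul]
      exact (mul_le_mul' hx1 hη).trans_eq (one_mul _)
  -- ## one of `N_1`, `N_αK` is a unit
  have hdiffN : (αK + g₀⁻¹ * ρ αK) - (1 + g₀⁻¹ * ρ 1) * αK = g₀⁻¹ * (ρ αK - αK) := by rw [map_one]; ring
  have hvdiffN : Valued.v ((αK + g₀⁻¹ * ρ αK) - (1 + g₀⁻¹ * ρ 1) * αK) = 1 := by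
    rw [hdiffN, Valuation.map_mul, map_inv₀, hvg₀, inv_one, one_mul, Valuation.map_sub_swap, hαKρ]
  have hN1le : Valued.v (1 + g₀⁻¹ * ρ 1) ≤ 1 :=
    (Valuation.map_add _ _ _).trans (max_le (by rw [Valuation.map_one]) (by rw [map_one, mul_one, map_inv₀, hvg₀, inv_one]))
  have hNαle : Valued.v (αK + g₀⁻¹ * ρ αK) ≤ 1 :=
    (Valuation.map_add _ _ _).trans (max_le hαK1 (by rw [Valuation.map_mul, map_inv₀, hvg₀, inv_one, one_mul, hvρ]; exact hαK1))
  by_cases hN1 : Valued.v (1 + g₀⁻¹ * ρ 1) = 1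
  · obtain ⟨hΘN, hN⟩ := hwit 1 (map_one Θ) (by rw [Valuation.map_one])
    exact ⟨_, hΘN, hN1, hN⟩
  · have hN1lt : Valued.v (1 + g₀⁻¹ * ρ 1) < 1 := lt_of_le_of_ne hN1le hN1
    have hNα : Valued.v (αK + g₀⁻¹ * ρ αK) = 1 := by
      by_contra hne
      have hlt : Valued.v (αK + g₀⁻¹ * ρ αK) < 1 := lt_of_le_of_ne hNαle hne
      have h2 : Valued.v ((αK + g₀⁻¹ * ρ αK) - (1 + g₀⁻¹ * ρ 1) * αK) < 1 := by
        refine lt_of_le_of_lt (Valuation.map_sub _ _ _) (max_lt hlt ?_)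
        rw [Valuation.map_mul]
        calc Valued.v (1 + g₀⁻¹ * ρ 1) * Valued.v αK ≤ Valued.v (1 + g₀⁻¹ * ρ 1) * 1 := by gcongr
          _ < 1 := by rw [mul_one]; exact hN1lt
      rw [hvdiffN] at h2
      exact lt_irrefl _ h2
    obtain ⟨hΘN, hN⟩ := hwit αK hΘαK hαK1
    exact ⟨_, hΘN, hNα, hN⟩

/-! ## §2 The top-depth law without suppliers -/

/-- **THE TOP-DEPTH LAW, SUPPLIER-FREE** (★ p857887 `exists_topDecomp_iff_add_le` with `hsurjD`, `hH90` and `d ≤ jλ` removed).  Frame as §1 (`hρϖ`: `ρϖE = ϖE`).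
For a unit `z` with `ρz = κ·z` (the (D3) hyperbolic unit: `κ = ρμ∕μ`), `|κ − Θκ| = exp(−jλ)`, and a depth `c ≥ 1`:
`(∃ k e w, Θk = k ∧ |k| = 1 ∧ ρe = e ∧ |e| = 1 ∧ |w − 1| ≤ exp(−c) ∧ z = k·e·w) ⟺ c + d ≤ jλ + 1` — `⟹` by ★ `add_le_of_thetaFixed_normOne_near` at `x := ρk∕k`,
`⟸` by §1's witness `N` (`k := N`, `z∕N ∈ 𝒪_Eˣ·U^{(c)}` by ★ `exists_fixed_mul_near_one_iff_mem_order`). [cite: Serre1979, Ch. V §3 Prop. 5; Ch. III §6 Prop. 12]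
[cite: Kottwitz1986BaseChangeUnits, §1 pp. 240–241] -/
theorem exists_topDecomp_iff_le (hρρ : ∀ x, ρ (ρ x) = x) (hΘΘ : ∀ x, Θ (Θ x) = x) (hΘρ : ∀ x, Θ (ρ x) = ρ (Θ x))
    (hvρ : ∀ x, Valued.v (ρ x) = Valued.v x) (hvΘ : ∀ x, Valued.v (Θ x) = Valued.v x)
    (hϖE : Valued.v ϖE = exp (-1 : ℤ)) (hρϖ : ρ ϖE = ϖE) {d : ℕ} (hdatum : Valued.v (ϖE - Θ ϖE) = Valued.v ϖE ^ d)
    (hΘev : ∀ x : K, Θ x = x → x ≠ 0 → ∃ n : ℤ, Valued.v x = exp (2 * n))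
    {αK : K} (hΘαK : Θ αK = αK) (hαK1 : Valued.v αK ≤ 1) (hαKρ : Valued.v (αK - ρ αK) = 1)
    {z κ : K} (hz1 : Valued.v z = 1) (hκz : ρ z = κ * z) {jl : ℕ} (hκΘ : Valued.v (κ - Θ κ) = exp (-(jl : ℤ))) {c : ℕ} (hc : 1 ≤ c) :
    (∃ k e w : K, Θ k = k ∧ Valued.v k = 1 ∧ ρ e = e ∧ Valued.v e = 1 ∧ Valued.v (w - 1) ≤ exp (-(c : ℤ)) ∧ z = k * e * w) ↔ c + d ≤ jl + 1 := by
  have hz0 : z ≠ 0 := fun h0 => by rw [h0, map_zero] at hz1; exact zero_ne_one hz1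
  have hρz0 : ρ z ≠ 0 := (map_ne_zero ρ).2 hz0
  have hκeq : κ = ρ z / z := by rw [eq_div_iff hz0, hκz]
  have hκ : κ * ρ κ = 1 := by rw [hκeq, map_div₀, hρρ]; field_simp
  have hκ1 : Valued.v κ = 1 := v_eq_one_of_mul_map_eq_one hvρ hκ
  have hαne : ρ αK ≠ αK := fun h0 => by rw [h0, sub_self, map_zero] at hαKρ; exact zero_ne_one hαKρ
  have hint : ∀ y : K, Valued.v y ≤ 1 → Valued.v ((y - ρ y) / (αK - ρ αK)) ≤ 1 := fun y hy => by
    rw [map_div₀, hαKρ, div_one]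
    exact (Valuation.map_sub _ _ _).trans (max_le hy (by rw [hvρ]; exact hy))
  constructor
  · rintro ⟨k, e, w, hΘk, hvk, hρe, hve, hw, hzeq⟩
    have hk0 : k ≠ 0 := fun h0 => by rw [h0, map_zero] at hvk; exact zero_ne_one hvk
    have he0 : e ≠ 0 := fun h0 => by rw [h0, map_zero] at hve; exact zero_ne_one hve
    have hvw : Valued.v w = 1 := v_eq_one_of_v_sub_one_le hc hw
    have hw0 : w ≠ 0 := fun h0 => by rw [h0, map_zero] at hvw; exact zero_ne_one hvw
    have hρk0 : ρ k ≠ 0 := (map_ne_zero ρ).2 hk0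
    -- `x := ρk∕k ∈ T♮` is within `exp(−c)` of `κ`
    have hΘx : Θ (ρ k / k) = ρ k / k := by rw [map_div₀, hΘρ, hΘk]
    have hx : ρ k / k * ρ (ρ k / k) = 1 := by rw [map_div₀, hρρ]; field_simp
    have hκx : κ - ρ k / k = ρ k / k * ((ρ w - w) / w) := by
      rw [hκeq, hzeq, map_mul, map_mul, hρe]; field_simp
    have hvκx : Valued.v (κ - ρ k / k) ≤ exp (-(c : ℤ)) := by
      rw [hκx, Valuation.map_mul, map_div₀, hvρ, hvk, div_one, one_mul, map_div₀, hvw, div_one,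
        show ρ w - w = -((w - 1) - ρ (w - 1)) by rw [map_sub, map_one]; ring, Valuation.map_neg]
      exact (Valuation.map_sub _ _ _).trans (max_le hw (by rw [hvρ]; exact hw))
    exact add_le_of_thetaFixed_normOne_near hρρ hΘΘ (fun x => (hΘρ x).symm) hvρ hvΘ hϖE hdatum hΘev hαK1 hαKρ hκ hκΘ.ge hΘx hx hc hvκx
  · intro hcd
    obtain ⟨N, hΘN, hN1, hN⟩ :=
      exists_thetaFixed_unit_near_top hρρ hΘΘ hΘρ hvρ hϖE hρϖ hdatum hΘαK hαK1 hαKρ hκ hκΘ (by omega)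
    have hN0 : N ≠ 0 := fun h0 => by rw [h0, map_zero] at hN1; exact zero_ne_one hN1
    have hρN0 : ρ N ≠ 0 := (map_ne_zero ρ).2 hN0
    -- `V := z ∕ N ∈ 𝒪_cˣ`
    have hV1 : Valued.v (z / N) = 1 := by rw [map_div₀, hz1, hN1, div_one]
    have hVρ : z / N - ρ (z / N) = z / N * ((ρ N - κ * N) / ρ N) := by rw [map_div₀, hκz]; field_simp
    have hvVρ : Valued.v (z / N - ρ (z / N)) ≤ Valued.v (ϖE ^ c * (αK - ρ αK)) := by
      rw [hVρ, Valuation.map_mul, hV1, one_mul, map_div₀, hvρ, hN1, div_one, Valuation.map_sub_swap,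
        Valuation.map_mul, Valuation.map_pow, hαKρ, mul_one, v_varpi_pow hϖE]
      exact hN.trans (by rw [exp_le_exp]; omega)
    obtain ⟨e, w, hρe, hve, hw, hVeq⟩ := (exists_fixed_mul_near_one_iff_mem_order hρρ hvρ hαne hαK1 hint hρϖ hϖE c hV1).1 ⟨hV1.le, hvVρ⟩
    refine ⟨N, e, w, hΘN, hN1, hρe, hve, hw, ?_⟩
    rw [mul_assoc, ← hVeq]; field_simp

/-! ## §3 The two line models in one unit -/

/-- **TRANSLATING THE SIDE SCALAR BY A NORM does not change the bit**: for a unit `ω₀` and any radius `r`, `BIT(h·ω₀Θω₀, μ, r) ⟺ BIT(h, μ, r)` — the twist `t(ω) = ρ(ωΘω)∕(ωΘω)`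
is multiplicative and `ρ(hN₀)∕(hN₀) = (ρh∕h)·t(ω₀)`. [cite: Jacobowitz1962, §4] -/
theorem topBit_mul_norm_iff (h μ : K) (ω₀ : Kˣ) (hω₀ : Valued.v (ω₀ : K) = 1) (r : ℤᵐ⁰) :
    (∃ ω₁ : Kˣ, Valued.v (ω₁ : K) = 1 ∧
        Valued.v (1 + ρ (h * ((ω₀ : K) * Θ ω₀)) / (h * ((ω₀ : K) * Θ ω₀)) / (ρ μ / μ) * (ρ ((ω₁ : K) * Θ ω₁) / ((ω₁ : K) * Θ ω₁))) ≤ r) ↔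
      ∃ ω₁ : Kˣ, Valued.v (ω₁ : K) = 1 ∧ Valued.v (1 + ρ h / h / (ρ μ / μ) * (ρ ((ω₁ : K) * Θ ω₁) / ((ω₁ : K) * Θ ω₁))) ≤ r := by
  have hN0 : ∀ ω : Kˣ, (ω : K) * Θ ω ≠ 0 := fun ω => mul_ne_zero ω.ne_zero ((map_ne_zero Θ).2 ω.ne_zero)
  have hρN0 : ∀ ω : Kˣ, ρ ((ω : K) * Θ ω) ≠ 0 := fun ω => (map_ne_zero ρ).2 (hN0 ω)
  -- the key identity, for any `ω₁`: twist of `hN₀` at `ω₁` = twist of `h` at `ω₀ω₁`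
  have hkey : ∀ ω₁ : Kˣ, ρ (h * ((ω₀ : K) * Θ ω₀)) / (h * ((ω₀ : K) * Θ ω₀)) / (ρ μ / μ) * (ρ ((ω₁ : K) * Θ ω₁) / ((ω₁ : K) * Θ ω₁)) =
      ρ h / h / (ρ μ / μ) * (ρ (((ω₀ * ω₁ : Kˣ) : K) * Θ ((ω₀ * ω₁ : Kˣ) : K)) / (((ω₀ * ω₁ : Kˣ) : K) * Θ ((ω₀ * ω₁ : Kˣ) : K))) := fun ω₁ => by
    have h1 : ((ω₀ * ω₁ : Kˣ) : K) * Θ ((ω₀ * ω₁ : Kˣ) : K) = ((ω₀ : K) * Θ ω₀) * ((ω₁ : K) * Θ ω₁) := by rw [Units.val_mul, map_mul]; ring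
    rw [h1]
    simp only [map_mul]
    field_simp
  constructor
  · rintro ⟨ω₁, hω₁, hle⟩
    refine ⟨ω₀ * ω₁, by rw [Units.val_mul, Valuation.map_mul, hω₀, hω₁, mul_one], ?_⟩
    rw [← hkey]; exact hle
  · rintro ⟨ω₁, hω₁, hle⟩
    refine ⟨ω₀⁻¹ * ω₁, by rw [Units.val_mul, Valuation.map_mul, Units.val_inv_eq_inv_val, map_inv₀, hω₀, inv_one, one_mul, hω₁], ?_⟩
    rw [hkey, mul_inv_cancel_left]; exact hle

/-- **THE TWO LINE MODELS IN ONE UNIT.**  Frame: `ρ, Θ` commuting involutions, isometric; `ϖE` a `ρ`-fixed uniformiser; `Θ`-fixed non-zero elements of even valuation;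
`αK` integral `Θ`-fixed with `|αK − ραK| = 1`.  For a HYPERBOLIC `Θ`-fixed scalar `h` (some `x ≠ 0` has `hΘx·x + ρ(hΘx·x) = 0`), an ANISOTROPIC `Θ`-fixed scalar `h′`
(no such `x`), and `μ ≠ 0` (here `αK` is any integral element with `|αK − ραK| = 1`), there are a unit `z` with `ρz = (ρμ∕μ)·z` and a `Θ`-fixed unit NON-norm `n₀`
such that for every depth `c ≥ 1`:
`BIT(h, μ, c) ⟺ ALIVE(z, c)` and `BIT(h′, μ, c) ⟺ ALIVE(z·n₀, c)`, where `ALIVE(z, c) := ∃ x e w, |x| = 1 ∧ ρe = e ∧ |e| = 1 ∧ |w − 1| ≤ exp(−c) ∧ z = xΘx·e·w`.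
(`z` is the unit part of `μ·hN(ω₀)·(αK − ραK)` for the translator `ω₀` of ★ `exists_unit_twist_eq_of_isotropic`; `h′ = hN(ω₀)·n₀·(ϖEΘϖE)^{-n}`; ★ p857848 bridge twice;
`n₀ ∉ N` by ★ `isotropic_of_mul_map_eq`.) [cite: Jacobowitz1962, §4] [cite: Serre1979, Ch. III §6 Prop. 12; Ch. X §1] -/
theorem exists_unit_of_lineModels (hρρ : ∀ x, ρ (ρ x) = x) (hΘΘ : ∀ x, Θ (Θ x) = x) (hΘρ : ∀ x, Θ (ρ x) = ρ (Θ x))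
    (hvρ : ∀ x, Valued.v (ρ x) = Valued.v x) (hvΘ : ∀ x, Valued.v (Θ x) = Valued.v x)
    (hϖE : Valued.v ϖE = exp (-1 : ℤ)) (hρϖ : ρ ϖE = ϖE)
    (hΘev : ∀ x : K, Θ x = x → x ≠ 0 → ∃ n : ℤ, Valued.v x = exp (2 * n))
    {αK : K} (hαK1 : Valued.v αK ≤ 1) (hαKρ : Valued.v (αK - ρ αK) = 1)
    {h h' : K} (hΘh : Θ h = h) (hh : h ≠ 0) (hhyper : ∃ x : K, x ≠ 0 ∧ h * Θ x * x + ρ (h * Θ x * x) = 0)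
    (hΘh' : Θ h' = h') (hh' : h' ≠ 0) (haniso : ¬ ∃ x : K, x ≠ 0 ∧ h' * Θ x * x + ρ (h' * Θ x * x) = 0)
    {μ : K} (hμ0 : μ ≠ 0) :
    ∃ z n₀ : K, Valued.v z = 1 ∧ ρ z = ρ μ / μ * z ∧ Θ n₀ = n₀ ∧ Valued.v n₀ = 1 ∧ (¬ ∃ x : K, x * Θ x = n₀) ∧
      (∀ c : ℕ, 1 ≤ c →
        ((∃ ω₁ : Kˣ, Valued.v (ω₁ : K) = 1 ∧ Valued.v (1 + ρ h / h / (ρ μ / μ) * (ρ ((ω₁ : K) * Θ ω₁) / ((ω₁ : K) * Θ ω₁))) ≤ exp (-(c : ℤ))) ↔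
          ∃ x e w : K, Valued.v x = 1 ∧ ρ e = e ∧ Valued.v e = 1 ∧ Valued.v (w - 1) ≤ exp (-(c : ℤ)) ∧ z = x * Θ x * e * w)) ∧
      (∀ c : ℕ, 1 ≤ c →
        ((∃ ω₁ : Kˣ, Valued.v (ω₁ : K) = 1 ∧ Valued.v (1 + ρ h' / h' / (ρ μ / μ) * (ρ ((ω₁ : K) * Θ ω₁) / ((ω₁ : K) * Θ ω₁))) ≤ exp (-(c : ℤ))) ↔
          ∃ x e w : K, Valued.v x = 1 ∧ ρ e = e ∧ Valued.v e = 1 ∧ Valued.v (w - 1) ≤ exp (-(c : ℤ)) ∧ z * n₀ = x * Θ x * e * w)) := by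
  have hρΘ : ∀ x, ρ (Θ x) = Θ (ρ x) := fun x => (hΘρ x).symm
  have hϖ0 : ϖE ≠ 0 := (v_varpi_zpow hϖE 0).1
  have hαne : αK - ρ αK ≠ 0 := fun h0 => by rw [h0, map_zero] at hαKρ; exact zero_ne_one hαKρ
  have hρμ0 : ρ μ ≠ 0 := (map_ne_zero ρ).2 hμ0
  -- ## the translator `ω₀` and the anti-fixed scalar `H := h·N(ω₀)`
  obtain ⟨ω₀, hω₀, hη⟩ := exists_unit_twist_eq_of_isotropic hΘρ hϖE hρϖ hh hhyper
  have hN₀0 : (ω₀ : K) * Θ ω₀ ≠ 0 := mul_ne_zero ω₀.ne_zero ((map_ne_zero Θ).2 ω₀.ne_zero)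
  have hvN₀ : Valued.v ((ω₀ : K) * Θ ω₀) = 1 := by rw [Valuation.map_mul, hvΘ, hω₀, mul_one]
  set H : K := h * ((ω₀ : K) * Θ ω₀) with hHdef
  have hΘH : Θ H = H := by rw [hHdef, map_mul, map_mul, hΘΘ, hΘh, mul_comm (Θ (ω₀ : K))]
  have hH0 : H ≠ 0 := mul_ne_zero hh hN₀0
  have hρH : ρ H = -H := by
    have h1 : ρ h * ρ ((ω₀ : K) * Θ ω₀) = -(h * ((ω₀ : K) * Θ ω₀)) := by
      have := hη; field_simp at this; linear_combination this
    rw [hHdef, map_mul, h1]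
  -- ## the unit `z`: `μ·H·(αK − ραK) = ϖE^n·z`
  have hP0 : μ * H * (αK - ρ αK) ≠ 0 := mul_ne_zero (mul_ne_zero hμ0 hH0) hαne
  obtain ⟨n, z, hz1, hPeq⟩ := exists_eq_varpi_zpow_mul_unit hϖE hP0
  have hπ0 : ϖE ^ n ≠ 0 := zpow_ne_zero n hϖ0
  have hρπ : ρ (ϖE ^ n) = ϖE ^ n := by rw [map_zpow₀, hρϖ]
  have hκz : ρ z = ρ μ / μ * z := by
    have h1 : ρ (μ * H * (αK - ρ αK)) = ρ μ / μ * (μ * H * (αK - ρ αK)) := by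
      rw [map_mul, map_mul, map_sub, hρρ, hρH]; field_simp; ring
    rw [hPeq, map_mul, hρπ] at h1
    exact mul_left_cancel₀ hπ0 (by linear_combination h1)
  -- ## the anisotropic scalar: `h′ = H·g`, `g = n₀·π₂^{-n'}` with `n₀` a `Θ`-fixed unit
  set π₂ : K := ϖE * Θ ϖE with hπ₂
  have hρπ₂ : ρ π₂ = π₂ := by rw [hπ₂, map_mul, hρϖ, hρΘ, hρϖ]
  have hΘπ₂ : Θ π₂ = π₂ := by rw [hπ₂, map_mul, hΘΘ, mul_comm]
  have hvπ₂ : Valued.v π₂ = exp (-2 : ℤ) := by rw [hπ₂, Valuation.map_mul, hvΘ, hϖE, ← exp_add]; rfl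
  have hπ₂0 : π₂ ≠ 0 := fun h0 => by rw [h0, map_zero] at hvπ₂; exact (exp_ne_zero hvπ₂.symm).elim
  have hΘg : Θ (h' / H) = h' / H := by rw [map_div₀, hΘh', hΘH]
  have hg0 : h' / H ≠ 0 := div_ne_zero hh' hH0
  obtain ⟨n', hn'⟩ := hΘev (h' / H) hΘg hg0
  set n₀ : K := h' / H * π₂ ^ n' with hn₀def
  have hΘn : Θ n₀ = n₀ := by rw [hn₀def, map_mul, map_zpow₀, hΘg, hΘπ₂]
  have hvn : Valued.v n₀ = 1 := by
    rw [hn₀def, Valuation.map_mul, map_zpow₀, hn', hvπ₂, ← exp_zsmul, ← exp_add, ← exp_zero]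
    congr 1; simp only [smul_eq_mul]; ring
  have hn0 : n₀ ≠ 0 := fun h0 => by rw [h0, map_zero] at hvn; exact zero_ne_one hvn
  have hπn0 : π₂ ^ n' ≠ 0 := zpow_ne_zero n' hπ₂0
  have hh'eq : h' = H * n₀ * (π₂ ^ n')⁻¹ := by rw [hn₀def]; field_simp
  -- `μ·h′·(αK − ραK) = π′·(z·n₀)` with the `ρ`-fixed `π′ := ϖE^n·(π₂^n')⁻¹`
  have hπ'0 : ϖE ^ n * (π₂ ^ n')⁻¹ ≠ 0 := mul_ne_zero hπ0 (inv_ne_zero hπn0)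
  have hρπ' : ρ (ϖE ^ n * (π₂ ^ n')⁻¹) = ϖE ^ n * (π₂ ^ n')⁻¹ := by simp only [map_mul, map_inv₀, map_zpow₀, hρϖ, hρπ₂]
  have hP'eq : μ * h' * (αK - ρ αK) = ϖE ^ n * (π₂ ^ n')⁻¹ * (z * n₀) := by
    rw [hh'eq]; linear_combination (n₀ * (π₂ ^ n')⁻¹) * hPeq
  have hzn1 : Valued.v (z * n₀) = 1 := by rw [Valuation.map_mul, hz1, hvn, mul_one]
  -- `n₀` is not a norm (else `h′` would be isotropic)
  have hnn : ¬ ∃ x : K, x * Θ x = n₀ := by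
    rintro ⟨x, hx⟩
    apply haniso
    have hy : x * (ϖE ^ n')⁻¹ * Θ (x * (ϖE ^ n')⁻¹) = n₀ * (π₂ ^ n')⁻¹ := by
      rw [map_mul, map_inv₀, map_zpow₀, hπ₂, mul_zpow, ← hx]; field_simp
    have hg'0 : n₀ * (π₂ ^ n')⁻¹ ≠ 0 := mul_ne_zero hn0 (inv_ne_zero hπn0)
    obtain ⟨y, hy0, hyiso⟩ := isotropic_of_mul_map_eq (Θ := Θ) hρH hg'0 hy
    refine ⟨y, hy0, ?_⟩
    rw [hh'eq, mul_assoc H]; exact hyiso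
  refine ⟨z, n₀, hz1, hκz, hΘn, hvn, hnn, fun c hc => ?_, fun c hc => ?_⟩
  · -- hyperbolic: BIT(h) ⟺ BIT(H) ⟺ ALIVE(z)
    rw [← topBit_mul_norm_iff (Θ := Θ) h μ ω₀ hω₀ (exp (-(c : ℤ)))]
    exact F0P3cDyRamTopBitNormBridge.topBit_iff_exists_norm_decomp hρρ hΘΘ hρΘ hvρ hvΘ hϖE hρϖ hΘev hαK1 hαKρ hΘH hH0 hμ0 hρπ hπ0 hPeq hz1 hc
  · -- anisotropic: BIT(h′) ⟺ ALIVE(z·n₀)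
    exact F0P3cDyRamTopBitNormBridge.topBit_iff_exists_norm_decomp hρρ hΘΘ hρΘ hvρ hvΘ hϖE hρϖ hΘev hαK1 hαKρ hΘh' hh' hμ0 hρπ' hπ'0 hP'eq hzn1 hc

end Summit.HodgeConjecture.HodgeConjecture.Cruxes.H413.F0P3cDyRamToricLevelCensusRamK
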